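import Summits.QuantumFields.YangMills.Theorems.MirrorModularBoostsCurvatureBoostCovarianceOrbitGluing
import Summits.QuantumFields.YangMills.Theorems.MirrorModularBoostsCurvatureBoostCovarianceOrbitGenericUpgrade
import Summits.QuantumFields.YangMills.Theorems.MirrorModularBoostsCurvatureBoostCovarianceOrbitAllAngles
import Summits.QuantumFields.YangMills.Theorems.MirrorModularBoostsCurvatureBoostCovarianceOrbitLocalContinuation
import Summits.QuantumFields.YangMills.Theorems.NPointIsotropy.Negative.NPointRegularJunk
import Summits.QuantumFields.YangMills.Theorems.PencilRigidityNPointIsotropyMopupHelpers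
import Summits.QuantumFields.YangMills.Theorems.PencilRigidityNPointIsotropyBandlimit
import Literature.MathematicalPhysics.QuantumFieldTheory.OSLorentzInvariance
import Literature.MathematicalPhysics.QuantumFieldTheory.OSReconstructionNoE1

/-!
# Stub 3 `stub_orbitBandlimit` — doubled orbit functions are trigonometric polynomials

Line `boosts-inherit-mirrors` of the crux `MirrorModularBoosts.CurvatureBoostCovariance` (stmt-QuantumFields-9663),
registered Stub 3 of the checked skeleton (reshape 4), proved VERBATIM (`stub_orbitBandlimit`), closed modulo its
explicit first hypothesis (the text of Stub 4a `stub_uniformPlanarBoostVectors`).  For a one-species family `S₁`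
on `ℝ⁴` with the OS package, translations and proper hypercubic invariance on `⁰𝒮`, the eight planar frames, the
planar cone and the function residual `NPointRegular`, the ORBIT FUNCTION `θ ↦ 𝔖_{n+m}(R_θ · H)`
(`R_θ = planeRot 0 θ`) of every witness `H` of `ΘF* ⊗ G` (`F`, `G` compactly supported, `e₀`-time-ordered) is a
trigonometric polynomial `Σ_{|k| ≤ K} c_k e^{4ikθ}`.

Proof (assembly of the four landed sibling stubs; the degree `K = ⌈Nₑ/4⌉₊` is in fact uniform in `H`,
`OrbitBandlimitFinal.trigPoly_offDiagonal`):
1. uniform planar boost vectors (the hypothesis) at `(S₁, h)`, `h : OSReconstructionNoE1` assembled from E2 (in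
   `OSPackage`) and `Translations`;
2. `stub_orbitLocalContinuation` (Stub 3d): local holomorphic continuation of the orbit function near the angle `0`,
   uniform type `Nₑ`, for compactly supported `X` with `e₀`-generic support;
3. `stub_orbitAllAngles` (Stub 3c): the same near EVERY angle for planar-generic compact supports (two frames, the
   quarter turn in `Hypercubic`);
4. `stub_orbitGluing` (Stub 3a): the local continuations glue to an ENTIRE `π/2`-periodic function of exponential
   type `Nₑ` (periodicity on `ℝ` from the quarter turn, `OrbitBandlimit.orbit_add_pi_div_two`);
5. `orbit_trigPoly_of_entire_deg`: the landed Paley–Wiener lemma `ComplexRotationBandlimit.stub_bandlimit` gives a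
   trigonometric polynomial of degree `⌈Nₑ/4⌉₊`;
6. `stub_orbitGenericUpgrade` (Stub 3b): the a.e. upgrade under the function residual, from the algebraic generic
   set (`exists_generic_set`: open, conull, planar-generic at every angle) to all of `⁰𝒮`, in particular to the
   doubled witnesses (`isOffDiagonal_of_isAppendTensorOf`).

References: K. Osterwalder, R. Schrader, Comm. Math. Phys. 31 (1973) §4; 42 (1975) §IV–V; R. P. Boas, Entire
Functions (1954) ch. 6 (Paley–Wiener).  `exists_generic_set` / `planeRot_zero_one` are copies (attributed) of the
landed `Mopup` lemmas of `Theorems/PencilRigidityNPointIsotropyMopup.lean` (olean unbuilt on the farm).  No `def`;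
helpers in the sub-namespace `OrbitBandlimitFinal`.
-/

noncomputable section

-- tree-known workaround (keep this line, it is in every landed Negative/*.lean file):
attribute [-instance] SimplexCategory.instFintypeToTypeOrderHomFinHAddNatLenOfNat

namespace Summit.QuantumFields.YangMills.Theorems.CurvatureBoostCovariance.BoostsInheritMirrors

open scoped BigOperators SchwartzMap
open MeasureTheory Filter Topology
open Literature.MathematicalPhysics.QuantumLattice Literature.MathematicalPhysics.AQFT
  Literature.MathematicalPhysics.QuantumFieldTheory
open Summit.QuantumFields.YangMills.Theorems.NPointIsotropy.Negative (E4 NPointRegular)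
open Summit.QuantumFields.YangMills.Theorems.CurvatureBoostCovariance.Negative
  (OSPackage Translations Hypercubic EightFrameRP PlanarCone isOffDiagonal_linActMulti)
open Summit.QuantumFields.YangMills.Theorems.NPointIsotropy.ComplexRotationBandlimit (stub_bandlimit)
open Summit.QuantumFields.YangMills.Theorems.NPointIsotropy.ComplexRotationBandlimit.Mopup
  (volume_pairing_eq_zero continuous_pairing)

namespace OrbitBandlimitFinal

variable {N : ℕ}

/-! ## §1 The Paley–Wiener back end with explicit degree -/

/-- **Back end with explicit degree.**  If the orbit function `θ ↦ 𝔖_N(R_θ · H)` of an off-diagonal `H` is the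
restriction to `ℝ` of an entire function `Φ` with `‖Φ z‖ ≤ C e^{Nₑ |Im z|}`, then for every `K` with
`Nₑ < 4(K+1)` it is a trigonometric polynomial `∑_{|k| ≤ K} c_k e^{4ikθ}`: the quarter turn in `Hypercubic S₁` makes
`Φ|ℝ` `π/2`-periodic (`OrbitBandlimit.orbit_add_pi_div_two`), the identity theorem makes `Φ` periodic on `ℂ`
(`OrbitBandlimit.periodic_of_real`), and the landed Paley–Wiener lemma `ComplexRotationBandlimit.stub_bandlimit`
concludes. -/
theorem orbit_trigPoly_of_entire_deg {S₁ : SchwingerFamily E4} (hhyp : Hypercubic S₁)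
    {H : 𝓢((Fin N → E4), ℂ)} (hH : IsOffDiagonal H) (Φ : ℂ → ℂ) (C Nₑ : ℝ)
    (hΦ : Differentiable ℂ Φ) (hgr : ∀ z : ℂ, ‖Φ z‖ ≤ C * Real.exp (Nₑ * |z.im|))
    (hres : ∀ θ : ℝ, Φ θ = S₁ N (linActMulti (planeRot (0 : Fin 3) θ) H)) (K : ℕ)
    (hK : Nₑ < 4 * ((K : ℝ) + 1)) :
    ∃ c : ℤ → ℂ, ∀ θ : ℝ,
      S₁ N (linActMulti (planeRot (0 : Fin 3) θ) H) =
        ∑ k ∈ Finset.Icc (-(K : ℤ)) K, c k * Complex.exp (4 * (k : ℂ) * (θ : ℂ) * Complex.I) := by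
  have hperR : ∀ t : ℝ, Φ (t + (Real.pi / 2 : ℝ)) = Φ t := by
    intro t
    have := hres (t + Real.pi / 2)
    rw [OrbitBandlimit.orbit_add_pi_div_two hhyp hH t, ← hres t] at this
    simpa using this
  have hper : ∀ z : ℂ, Φ (z + (Real.pi / 2 : ℝ)) = Φ z := OrbitBandlimit.periodic_of_real hΦ _ hperR
  obtain ⟨c, hc⟩ := stub_bandlimit Φ C Nₑ K hΦ hper hgr hK
  exact ⟨c, fun θ => by rw [← hres θ, hc θ]⟩

/-- The degree `⌈Nₑ/4⌉₊` is admissible: `Nₑ < 4(⌈Nₑ/4⌉₊ + 1)`. -/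
theorem lt_four_mul_ceil (Nₑ : ℝ) : Nₑ < 4 * ((⌈Nₑ / 4⌉₊ : ℝ) + 1) := by
  have h1 : Nₑ / 4 ≤ (⌈Nₑ / 4⌉₊ : ℝ) := Nat.le_ceil _
  linarith

/-- A witness of `ΘF* ⊗ G` with `F`, `G` time-ordered is off-diagonal. -/
theorem isOffDiagonal_of_isAppendTensorOf {n m : ℕ} {F : 𝓢((Fin n → E4), ℂ)} {G : 𝓢((Fin m → E4), ℂ)}
    (hF : IsTimeOrdered F) (hG : IsTimeOrdered G) {H : 𝓢((Fin (n + m) → E4), ℂ)}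
    (hH : IsAppendTensorOf H (osAdjoint F) G) : IsOffDiagonal H := by
  have hHeq : H = (osAdjoint F).appendTensor G :=
    SchwartzMap.ext fun x => by rw [hH x]; exact (isAppendTensorOf_appendTensor _ _ x).symm
  rw [hHeq]
  exact OSReconstructionNoE1.isOffDiagonal_appendTensor_osAdjoint hF hG

/-! ## §2 The algebraic generic set (copied from the landed mop-up of the sibling crux) -/

/-- Coordinates `0` and `1` of the plane rotation `planeRot 0 φ` on `ℝ⁴`. [folklore] -/
-- copied from Theorems/PencilRigidityNPointIsotropyMopup.lean (`Mopup.planeRot_zero_one`; olean unbuilt on the farm)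
theorem planeRot_zero_one (φ : ℝ) (y : E4) :
    (planeRot (0 : Fin 3) φ y) 0 = Real.cos φ * y 0 + Real.sin φ * y 1 ∧
      (planeRot (0 : Fin 3) φ y) 1 = -Real.sin φ * y 0 + Real.cos φ * y 1 := by
  refine ⟨by simp [planeRot_apply], ?_⟩
  rw [planeRot_apply]
  simp [Fin.succ_zero_eq_one]

/-- **The algebraic generic set**: an open CONULL set `G` of `n`-point configurations, avoiding the coincidence
locus, on which for EVERY angle `φ` the rotated configuration has pairwise distinct `x₀`-coordinates or pairwise
distinct `x₁`-coordinates (`G = {⟨π(xᵢ-xⱼ), π(x_k-x_l)⟩ ≠ 0}`; its complement is a finite union of null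
quadrics, landed `Mopup.volume_pairing_eq_zero`). [folklore] -/
-- copied from Theorems/PencilRigidityNPointIsotropyMopup.lean (`Mopup.exists_generic_set`; olean unbuilt on the farm)
theorem exists_generic_set (n : ℕ) :
    ∃ G : Set (Fin n → E4), IsOpen G ∧ volume Gᶜ = 0 ∧ G ⊆ (coincidenceLocus n E4)ᶜ ∧
      ∀ x ∈ G, ∀ φ : ℝ,
        (∀ i j : Fin n, i ≠ j → (planeRot (0 : Fin 3) φ (x i)) 0 ≠ (planeRot (0 : Fin 3) φ (x j)) 0) ∨
        (∀ i j : Fin n, i ≠ j → (planeRot (0 : Fin 3) φ (x i)) 1 ≠ (planeRot (0 : Fin 3) φ (x j)) 1) := by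
  set P : Fin n → Fin n → Fin n → Fin n → (Fin n → E4) → ℝ := fun i j k l x =>
    (x i 0 - x j 0) * (x k 0 - x l 0) + (x i 1 - x j 1) * (x k 1 - x l 1) with hP
  set G : Set (Fin n → E4) := ⋂ i, ⋂ j, ⋂ k, ⋂ l, {x | i ≠ j → k ≠ l → P i j k l x ≠ 0} with hG
  have hmem : ∀ x, x ∈ G ↔ ∀ i j k l : Fin n, i ≠ j → k ≠ l → P i j k l x ≠ 0 := fun x => by
    simp only [hG, Set.mem_iInter, Set.mem_setOf_eq]
  have hPc : ∀ i j k l, Continuous (P i j k l) := fun i j k l => continuous_pairing i j k l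
  have hfac : ∀ i j k l : Fin n, IsOpen {x : Fin n → E4 | i ≠ j → k ≠ l → P i j k l x ≠ 0} ∧
      volume {x : Fin n → E4 | i ≠ j → k ≠ l → P i j k l x ≠ 0}ᶜ = 0 := by
    intro i j k l
    by_cases hij : i = j
    · simp [hij]
    by_cases hkl : k = l
    · simp [hkl]
    have hset : {x : Fin n → E4 | i ≠ j → k ≠ l → P i j k l x ≠ 0} = {x | P i j k l x ≠ 0} := by
      ext x; simp [hij, hkl]
    rw [hset]
    refine ⟨isOpen_ne_fun (hPc i j k l) continuous_const, ?_⟩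
    have hc : {x : Fin n → E4 | P i j k l x ≠ 0}ᶜ = {x | P i j k l x = 0} := by
      ext x; simp
    rw [hc]
    exact volume_pairing_eq_zero i j k l hij hkl
  refine ⟨G, ?_, ?_, ?_, ?_⟩
  · exact isOpen_iInter_of_finite fun i => isOpen_iInter_of_finite fun j =>
      isOpen_iInter_of_finite fun k => isOpen_iInter_of_finite fun l => (hfac i j k l).1
  · simp only [hG, Set.compl_iInter]
    exact measure_iUnion_null fun i => measure_iUnion_null fun j =>
      measure_iUnion_null fun k => measure_iUnion_null fun l => (hfac i j k l).2
  · rintro x hx ⟨i, j, hij, hxij⟩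
    have h := (hmem x).1 hx i j i j hij hij
    simp [hP, hxij] at h
  · intro x hx φ
    by_contra hcon
    simp only [not_or, not_forall, not_not, exists_prop] at hcon
    obtain ⟨⟨i, j, hij, h0⟩, ⟨k, l, hkl, h1⟩⟩ := hcon
    rw [(planeRot_zero_one φ (x i)).1, (planeRot_zero_one φ (x j)).1] at h0
    rw [(planeRot_zero_one φ (x k)).2, (planeRot_zero_one φ (x l)).2] at h1
    have hcs := Real.cos_sq_add_sin_sq φ
    refine (hmem x).1 hx i j k l hij hkl ?_
    simp only [hP]
    linear_combination (Real.cos φ * (x k 0 - x l 0) + Real.sin φ * (x k 1 - x l 1)) * h0 +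
      (-Real.sin φ * (x i 0 - x j 0) + Real.cos φ * (x i 1 - x j 1)) * h1 -
      ((x i 0 - x j 0) * (x k 0 - x l 0) + (x i 1 - x j 1) * (x k 1 - x l 1)) * hcs

/-! ## §3 The band limit on all of `⁰𝒮` with a uniform degree, from uniform planar boost vectors -/

/-- **The band limit on all of `⁰𝒮`, with a UNIFORM degree.**  For a family with the OS package, translations,
proper hypercubic invariance, the eight frames, the planar cone and the function residual, GIVEN uniform planar
boost vectors (the text of Stub 4a, as a hypothesis), in every degree `N` there is `K = K(S₁, N)` such that the
orbit function of EVERY off-diagonal `H` of degree `N` is a trigonometric polynomial `∑_{|k| ≤ K} c_k e^{4ikθ}`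
(chain: Stub 3d ⇒ Stub 3c ⇒ Stub 3a ⇒ Paley–Wiener ⇒ Stub 3b). -/
theorem trigPoly_offDiagonal
    (h₁ : ∀ (S₁ : SchwingerFamily E4) (h : OSReconstructionNoE1 S₁.toLabelled),
      S₁.toLabelled.HasLinearGrowth → S₁.toLabelled.IsSymmetric → EightFrameRP S₁ → PlanarCone S₁ →
      ∀ (n : ℕ), ∃ N : ℝ, ∀ (F : SchwartzMap (Fin n → E4) ℂ), IsTimeOrdered F →
        HasCompactSupport (F : (Fin n → E4) → ℂ) →
        ∃ ε : ℝ, 0 < ε ∧ ∃ (V : ℂ → h.Hilbert) (C : ℝ),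
          DifferentiableOn ℂ V {θ : ℂ | |θ.re| < ε} ∧
          (∀ θ : ℂ, |θ.re| < ε → ‖V θ‖ ≤ C * Real.exp (N * |θ.im|)) ∧
          ∀ θ : ℝ, |θ| < ε → ∀ hθ : IsTimeOrdered (linActMulti (planeRot (0 : Fin 3) θ) F),
            V θ = h.fieldVec n (fun _ => ()) (linActMulti (planeRot (0 : Fin 3) θ) F) hθ)
    (S₁ : SchwingerFamily E4) (hOS : OSPackage S₁) (htr : Translations S₁) (hhyp : Hypercubic S₁)
    (h8 : EightFrameRP S₁) (hC : PlanarCone S₁) (hreg : NPointRegular S₁) (N : ℕ) :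
    ∃ K : ℕ, ∀ H : 𝓢((Fin N → E4), ℂ), IsOffDiagonal H → ∃ c : ℤ → ℂ, ∀ θ : ℝ,
      S₁ N (linActMulti (planeRot (0 : Fin 3) θ) H) =
        ∑ k ∈ Finset.Icc (-(K : ℤ)) K, c k * Complex.exp (4 * (k : ℂ) * (θ : ℂ) * Complex.I) := by
  obtain ⟨-, -, hlg, hRP, hsym, -⟩ := hOS
  have h : OSReconstructionNoE1 S₁.toLabelled := ⟨hRP, fun n _ a X hX => htr n a X hX⟩
  obtain ⟨Nₑ, hloc⟩ := stub_orbitLocalContinuation S₁ h hsym (h₁ S₁ h hlg hsym h8 hC) N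
  obtain ⟨W, hW⟩ := hreg N
  obtain ⟨G, hGo, hG0, hGc, hGg⟩ := exists_generic_set N
  refine ⟨⌈Nₑ / 4⌉₊, fun H hH =>
    stub_orbitGenericUpgrade N (S₁ N) W hW G hGo hG0 hGc _ (fun X hXG hXc => ?_) H hH⟩
  have hXoff : IsOffDiagonal X := IsOffDiagonal.of_tsupport_subset (hXG.trans hGc)
  obtain ⟨Φ, C, hΦd, hΦg, hΦr⟩ := stub_orbitGluing
    (fun θ => S₁ N (linActMulti (planeRot (0 : Fin 3) θ) X)) Nₑ
    (stub_orbitAllAngles N S₁ hhyp Nₑ hloc X hXc fun x hx φ => hGg x (hXG hx) φ)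
    (fun s => OrbitBandlimit.orbit_add_pi_div_two hhyp hXoff s)
  exact orbit_trigPoly_of_entire_deg hhyp hXoff Φ C Nₑ hΦd hΦg hΦr _ (lt_four_mul_ceil Nₑ)

end OrbitBandlimitFinal

/-- **Stub 3 — DOUBLED ORBIT FUNCTIONS ARE TRIGONOMETRIC POLYNOMIALS, the registered signature VERBATIM** (closed
modulo its explicit first hypothesis, the text of Stub 4a `stub_uniformPlanarBoostVectors`).  For a one-species
family with the OS package, translation and proper hypercubic invariance on `⁰𝒮`, E2 in the eight planar frames, the
planar cone and the function residual, the orbit function `θ ↦ 𝔖_{n+m}(planeRot 0 θ · H)` of every witness `H` of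
`ΘF* ⊗ G` (`F`, `G` compactly supported, `e₀`-time-ordered) is a trigonometric polynomial `Σ_{|k|≤K} c_k e^{4ikθ}`
(`OrbitBandlimitFinal.trigPoly_offDiagonal` at the off-diagonal `H`; the degree is even uniform in `H`). -/
theorem stub_orbitBandlimit :
    open Literature.MathematicalPhysics.QuantumLattice Literature.MathematicalPhysics.AQFT
      Literature.MathematicalPhysics.QuantumFieldTheory
      Summit.QuantumFields.YangMills.Theorems.CurvatureBoostCovariance.Negative
      Summit.QuantumFields.YangMills.Theorems.NPointIsotropy.Negative in
    (∀ (S₁ : SchwingerFamily E4) (h : OSReconstructionNoE1 S₁.toLabelled),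
      S₁.toLabelled.HasLinearGrowth → S₁.toLabelled.IsSymmetric → EightFrameRP S₁ → PlanarCone S₁ →
      ∀ (n : ℕ), ∃ N : ℝ, ∀ (F : SchwartzMap (Fin n → E4) ℂ), IsTimeOrdered F →
        HasCompactSupport (F : (Fin n → E4) → ℂ) →
        ∃ ε : ℝ, 0 < ε ∧ ∃ (V : ℂ → h.Hilbert) (C : ℝ),
          DifferentiableOn ℂ V {θ : ℂ | |θ.re| < ε} ∧
          (∀ θ : ℂ, |θ.re| < ε → ‖V θ‖ ≤ C * Real.exp (N * |θ.im|)) ∧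
          ∀ θ : ℝ, |θ| < ε → ∀ hθ : IsTimeOrdered (linActMulti (planeRot (0 : Fin 3) θ) F),
            V θ = h.fieldVec n (fun _ => ()) (linActMulti (planeRot (0 : Fin 3) θ) F) hθ) →
    ∀ (S₁ : SchwingerFamily E4), OSPackage S₁ → Translations S₁ → Hypercubic S₁ → EightFrameRP S₁ →
      PlanarCone S₁ → NPointRegular S₁ →
      ∀ (n m : ℕ) (F : SchwartzMap (Fin n → E4) ℂ) (G : SchwartzMap (Fin m → E4) ℂ),
        IsTimeOrdered F → IsTimeOrdered G →
        HasCompactSupport (F : (Fin n → E4) → ℂ) → HasCompactSupport (G : (Fin m → E4) → ℂ) →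
        ∀ H : SchwartzMap (Fin (n + m) → E4) ℂ, IsAppendTensorOf H (osAdjoint F) G →
          ∃ (K : ℕ) (c : ℤ → ℂ), ∀ θ : ℝ,
            S₁ (n + m) (linActMulti (planeRot (0 : Fin 3) θ) H) =
              ∑ k ∈ Finset.Icc (-(K : ℤ)) K, c k * Complex.exp (4 * (k : ℂ) * (θ : ℂ) * Complex.I) := by
  intro hUPBV S₁ hOS htr hhyp h8 hC hreg n m F G hF hG _ _ H hH
  obtain ⟨K, hK⟩ := OrbitBandlimitFinal.trigPoly_offDiagonal hUPBV S₁ hOS htr hhyp h8 hC hreg (n + m)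
  exact ⟨K, hK H (OrbitBandlimitFinal.isOffDiagonal_of_isAppendTensorOf hF hG hH)⟩

end Summit.QuantumFields.YangMills.Theorems.CurvatureBoostCovariance.BoostsInheritMirrors

end
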